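import Literature.Computability.AlgebraicComplexity.LaserMethodTheorem
import Literature.Computability.AlgebraicComplexity.MaxEntropyGivenMarginals
import HarnessLib

/-!
# The laser method with general components, combinatorial layer: a large free diagonal inside ONE
joint type, and its size in terms of entropies and the penalty `Γ_S(P)` (Le Gall 2014, proof of
Thm. 4.1, Lemmas A.1–A.2) — proved

Topic `Literature/Computability/AlgebraicComplexity`.  Companion of `LaserMethodTypes.lean` (type
classes `I_μ`, typed supports `Φ = (I_μ × J_ν × L_π) ∩ S^N`, the free diagonal of BCS Thm. 15.41)
and `LaserMethodBlocks.lean` (tensor layer).  For components that are not matrix tensors the free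
diagonal has to be taken inside the set `Φ_Q ⊆ Φ` of triples of ONE joint type `Q` (Le Gall's
`Λ* ⊆ Λ`, "all those `(u,v,w)` such that `(a,b,c)` … are of type `P`", Appendix A.3), and the price
is the ratio `|Φ_Q| / |Φ| ≈ 2^{-N Γ_S(P)}`, `Γ_S(P) = max_Q H(Q) − H(P)` over the distributions `Q`
on `S` with the marginals of `P` (Le Gall §3, Def. of `Γ_S`; = `maxEntropyPenalty S P` of
`MaxEntropyGivenMarginals.lean`).  This file PROVES:

* `jointTypeClass N Q` — the triples of label words `(x,y,z)` whose word of triples has type `Q`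
  (`letterCount (labelSeq φ) = Q`); `card_jointTypeClass` (`= binom(N; Q)`),
  `jointTypeClass_subset_typedSupport` (for `Q` supported in `S`, with the marginal types of `Q`).
* `exists_free_diagonal_jointType` — **Le Gall Lemma A.2 applied** (the tree's relative hashing
  theorem `BCS1997_thm1539_free_sub` with a Bertrand prime and the Salem–Spencer diagonal, exactly as
  `exists_free_diagonal_typedSupport`): a free diagonal `Δ ⊆ Φ_Q` with
  `|Φ_Q| · rothNumberNat(3f') ≤ 288 f'² |Δ|`, `min{|I_μ|,|J_ν|,|L_π|} · f ≤ |Φ|`, `f' = max(f,b)`.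
* `two_rpow_le_card_jointTypeClass` (`2^{N H(P)} ≤ (N+1)^{|I×J×L|} |Φ_Q|`, `P = Q/N`) and
  `card_typedSupport_le_two_rpow_maxEntropy` (**`|Φ| ≤ (N+1)^{|I×J×L|} 2^{N max_{Q'} H(Q')}`**, the
  maximum over distributions on `S` with the marginals of `P`: every triple of `Φ` has a joint type
  with these marginals, Le Gall p. 24 "`N ≤ (N+1)^{3|S|} ∏ max_Q Φ'_{ℓ,N}(P,Q)`").
* `exists_free_diagonal_jointType_card` — the assembled **counting bound**:
  `2^{N (min_m H(P_m) − Γ_S(P))} ≤ |Δ| · (N+1)^{2G+A} · 96 b' · exp(4 √(log 3b' + N log G))`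
  (`G = |I×J×L|`, `A = |I|+|J|+|L|`, `b' = max(b,1)`; Behrend's bound for the Salem–Spencer loss),
  i.e. `|Δ| ≥ 2^{N(min_m H(P_m) − Γ_S(P)) − o(N)}`.

Everything is proved; one definition (`jointTypeClass`, an abbreviation); no named facts.

## References

* F. Le Gall, *Powers of tensors and fast matrix multiplication*, ISSAC 2014, arXiv:1401.7714
  (held: `paper:arxiv-1401.7714`): §3 (`Γ_S`), Thm. 4.1, Appendix A (Def. A.1, Lemmas A.1–A.2,
  §A.3 pp. 21–24). [LeGall2014]
* P. Bürgisser, M. Clausen, M. A. Shokrollahi, *Algebraic Complexity Theory* (1997), Thm. 15.39,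
  proof of Thm. 15.41 (pp. 380–381). [BurgisserClausenShokrollahi1997]
-/

noncomputable section

open scoped BigOperators
open Finset

namespace Literature.Computability.AlgebraicComplexity

/-! ## Triples of one joint type -/

section JointType

variable {I J L : Type*} [Fintype I] [Fintype J] [Fintype L] [DecidableEq I] [DecidableEq J]
  [DecidableEq L]

/-- **The triples of label words of joint type `Q`** (Le Gall's `Λ*`/"`(a,b,c)` has type `Q`":
every `s ∈ S` occurs at exactly `Q(s)` of the `N` coordinates).
[cite: LeGall2014, Appendix A.3 (definition of the type of (a,b,c))] -/
abbrev jointTypeClass (N : ℕ) (Q : I × J × L → ℕ) :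
    Finset ((Fin N → I) × (Fin N → J) × (Fin N → L)) :=
  Finset.univ.filter fun φ => letterCount (labelSeq φ) = Q

/-- The bijection "triple of words ↔ word of triples". [folklore] -/
def labelSeqEquiv (N : ℕ) : ((Fin N → I) × (Fin N → J) × (Fin N → L)) ≃ (Fin N → I × J × L) where
  toFun φ := labelSeq φ
  invFun w := (fun ρ => (w ρ).1, fun ρ => (w ρ).2.1, fun ρ => (w ρ).2.2)
  left_inv φ := by
    obtain ⟨x, y, z⟩ := φ
    rfl
  right_inv w := by
    funext ρ
    simp [labelSeq]

/-- `|Φ_Q|` is the number of words of type `Q` over the alphabet `I × J × L`. [folklore] -/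
theorem card_jointTypeClass_eq_card_typeClass (N : ℕ) (Q : I × J × L → ℕ) :
    (jointTypeClass N Q).card = (typeClass N Q).card := by
  classical
  refine Finset.card_bij (fun φ _ => labelSeqEquiv N φ) (fun φ hφ => ?_) (fun φ₁ _ φ₂ _ h => ?_)
    (fun w hw => ?_)
  · rw [mem_typeClass]
    exact (Finset.mem_filter.1 hφ).2
  · exact (labelSeqEquiv N).injective h
  · refine ⟨(labelSeqEquiv N).symm w, Finset.mem_filter.2 ⟨Finset.mem_univ _, ?_⟩, ?_⟩
    · have : labelSeq ((labelSeqEquiv N).symm w) = w := (labelSeqEquiv N).apply_symm_apply w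
      rw [this]
      exact mem_typeClass.1 hw
    · exact (labelSeqEquiv N).apply_symm_apply w

/-- **`|Φ_Q| = binom(N; Q)`** (Le Gall: `Φ'`-type counts are multinomial coefficients).
[cite: LeGall2014, Appendix A.1] -/
theorem card_jointTypeClass (N : ℕ) (Q : I × J × L → ℕ) (hQ : ∑ s, Q s = N) :
    (jointTypeClass N Q).card = Nat.multinomial Finset.univ Q := by
  rw [card_jointTypeClass_eq_card_typeClass, card_typeClass_eq_multinomial N Q hQ]

/-- A triple of joint type `Q`, `Q` supported in `S`, lies in the typed support of the marginal
types of `Q`. [cite: LeGall2014, Appendix A.3] -/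
theorem jointTypeClass_subset_typedSupport (S : Finset (I × J × L)) {N : ℕ} (Q : I × J × L → ℕ)
    (hQS : ∀ s, s ∉ S → Q s = 0) :
    jointTypeClass N Q ⊆ typedSupport S N (fun i => ∑ j, ∑ l, Q (i, j, l))
      (fun j => ∑ i, ∑ l, Q (i, j, l)) (fun l => ∑ i, ∑ j, Q (i, j, l)) := by
  intro φ hφ
  have hQ : letterCount (labelSeq φ) = Q := (Finset.mem_filter.1 hφ).2
  refine mem_typedSupport.2 ⟨?_, ?_, ?_, fun ρ => ?_⟩
  · funext i
    rw [← hQ, ← letterCount_fst]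
  · funext j
    rw [← hQ, ← letterCount_snd_fst]
  · funext l
    rw [← hQ, ← letterCount_snd_snd]
  · by_contra hρ
    have h0 := hQS _ hρ
    rw [← hQ] at h0
    exact (letterCount_pos_of_apply (labelSeq φ) ρ).ne' h0

end JointType

/-! ## A large free diagonal inside one joint type (Le Gall Lemma A.2 applied) -/

section FreeDiagonal

variable {I J L : Type*} [Fintype I] [Fintype J] [Fintype L] [DecidableEq I] [DecidableEq J]
  [DecidableEq L]

/-- **Le Gall 2014, Lemma A.2, applied to `Λ = Φ`, `Λ* = Φ_Q`.**  Let `S ⊆ I × J × L` be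
`b`-tight and `Q` a count vector supported in `S` with `∑ Q = N`; let `Φ` be the typed support of the
marginal types of `Q` and `Φ_Q ⊆ Φ` the triples of joint type `Q`.  Then there is a free diagonal
`Δ ⊆ Φ_Q` (free with respect to the coordinatewise support, as in
`exists_free_diagonal_typedSupport`) with, for some `f ≥ 1` with `min{|I_μ|,|J_ν|,|L_π|} · f ≤ |Φ|`
and `f' = max(f,b)`: `|Φ_Q| · rothNumberNat(3f') ≤ 288 f'² |Δ|` (relative hashing
`BCS1997_thm1539_free_sub`, Bertrand prime `6f' < M ≤ 12f'`, Salem–Spencer diagonal).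
[cite: LeGall2014, Lemma A.2 and Appendix A.3, Eq. (7)] -/
theorem exists_free_diagonal_jointType (S : Finset (I × J × L)) {r b : ℕ}
    (α : I → Fin r → ℤ) (β : J → Fin r → ℤ) (γ : L → Fin r → ℤ)
    (hα : Function.Injective α) (hβ : Function.Injective β) (hγ : Function.Injective γ)
    (hαb : ∀ i ρ, |α i ρ| ≤ b) (hβb : ∀ j ρ, |β j ρ| ≤ b)
    (htight : ∀ s ∈ S, ∀ ρ, α s.1 ρ + β s.2.1 ρ + γ s.2.2 ρ = 0)
    {N : ℕ} (Q : I × J × L → ℕ) (hQS : ∀ s, s ∉ S → Q s = 0) (hQ : ∑ s, Q s = N) :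
    ∃ Δ : Finset ((Fin N → I) × (Fin N → J) × (Fin N → L)), Δ ⊆ jointTypeClass N Q ∧
      (∀ δ ∈ Δ, ∀ δ' ∈ Δ, ∀ δ'' ∈ Δ, (∀ ρ, (δ.1 ρ, δ'.2.1 ρ, δ''.2.2 ρ) ∈ S) →
        δ = δ' ∧ δ' = δ'') ∧
      ∃ f : ℕ, 1 ≤ f ∧
        min (typeClass N fun i => ∑ j, ∑ l, Q (i, j, l)).card
            (min (typeClass N fun j => ∑ i, ∑ l, Q (i, j, l)).card
              (typeClass N fun l => ∑ i, ∑ j, Q (i, j, l)).card) * f ≤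
          (typedSupport S N (fun i => ∑ j, ∑ l, Q (i, j, l)) (fun j => ∑ i, ∑ l, Q (i, j, l))
            (fun l => ∑ i, ∑ j, Q (i, j, l))).card ∧
        (jointTypeClass N Q).card * rothNumberNat (3 * max f b) ≤ 288 * max f b ^ 2 * Δ.card := by
  classical
  -- notation: the marginal types, `Φ`, `Φ_Q`, a base point
  set μ : I → ℕ := fun i => ∑ j, ∑ l, Q (i, j, l) with hμ
  set ν : J → ℕ := fun j => ∑ i, ∑ l, Q (i, j, l) with hν
  set π : L → ℕ := fun l => ∑ i, ∑ j, Q (i, j, l) with hπ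
  obtain ⟨Φ, hΦ⟩ : ∃ Φ : Finset ((Fin N → I) × (Fin N → J) × (Fin N → L)),
      Φ = typedSupport S N μ ν π := ⟨_, rfl⟩
  have hsub : jointTypeClass N Q ⊆ Φ := hΦ ▸ jointTypeClass_subset_typedSupport S Q hQS
  obtain ⟨w₀, hw₀⟩ := typeClass_nonempty N Q hQ
  have hφ₀Q : (labelSeqEquiv N).symm w₀ ∈ jointTypeClass N Q := by
    refine Finset.mem_filter.2 ⟨Finset.mem_univ _, ?_⟩
    have : labelSeq ((labelSeqEquiv N).symm w₀) = w₀ := (labelSeqEquiv N).apply_symm_apply w₀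
    rw [this]; exact mem_typeClass.1 hw₀
  set φ₀ := (labelSeqEquiv N).symm w₀ with hφ₀def
  have hφ₀ : φ₀ ∈ Φ := hsub hφ₀Q
  obtain ⟨hμ₀, hν₀, hπ₀, -⟩ := mem_typedSupport.1 (hΦ ▸ hφ₀)
  rw [← hΦ]
  -- the tightness maps on words
  let αN : (Fin N → I) → Fin (N * r) → ℤ := fun x t =>
    α (x (finProdFinEquiv.symm t).1) (finProdFinEquiv.symm t).2
  let βN : (Fin N → J) → Fin (N * r) → ℤ := fun y t =>
    β (y (finProdFinEquiv.symm t).1) (finProdFinEquiv.symm t).2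
  let γN : (Fin N → L) → Fin (N * r) → ℤ := fun z t =>
    γ (z (finProdFinEquiv.symm t).1) (finProdFinEquiv.symm t).2
  have hαN : Function.Injective αN := wordVec_injective α hα
  have hβN : Function.Injective βN := wordVec_injective β hβ
  have hγN : Function.Injective γN := wordVec_injective γ hγ
  have hαNb : ∀ x t, |αN x t| ≤ b := fun x t => hαb _ _
  have hβNb : ∀ y t, |βN y t| ≤ b := fun y t => hβb _ _
  have htightN : ∀ φ ∈ Φ, ∀ t, αN φ.1 t + βN φ.2.1 t + γN φ.2.2 t = 0 := by
    intro φ hφ t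
    rw [hΦ] at hφ
    exact htight _ ((mem_typedSupport.1 hφ).2.2.2 _) _
  -- fibre sizes
  set f₁ := (Φ.filter fun φ => φ.1 = φ₀.1).card with hf₁
  set f₂ := (Φ.filter fun φ => φ.2.1 = φ₀.2.1).card with hf₂
  set f₃ := (Φ.filter fun φ => φ.2.2 = φ₀.2.2).card with hf₃
  set f := max f₁ (max f₂ f₃) with hf
  have hf₁1 : 1 ≤ f₁ := Finset.card_pos.2 ⟨φ₀, Finset.mem_filter.2 ⟨hφ₀, rfl⟩⟩
  have hf1 : 1 ≤ f := le_trans hf₁1 (le_max_left _ _)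
  have hfI : ∀ x, (Φ.filter fun φ => φ.1 = x).card ≤ f := fun x =>
    (hΦ ▸ card_fibre₁_le S μ ν π hμ₀ x).trans (le_max_left _ _)
  have hfJ : ∀ y, (Φ.filter fun φ => φ.2.1 = y).card ≤ f := fun y =>
    (hΦ ▸ card_fibre₂_le S μ ν π hν₀ y).trans ((le_max_left _ _).trans (le_max_right _ _))
  have hfL : ∀ z, (Φ.filter fun φ => φ.2.2 = z).card ≤ f := fun z =>
    (hΦ ▸ card_fibre₃_le S μ ν π hπ₀ z).trans ((le_max_right _ _).trans (le_max_right _ _))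
  have hΦ₁ : Φ.card = (typeClass N μ).card * f₁ := by
    rw [hf₁, hΦ]; exact card_typedSupport_eq_mul_fibre₁ S μ ν π hμ₀
  have hΦ₂ : Φ.card = (typeClass N ν).card * f₂ := by
    rw [hf₂, hΦ]; exact card_typedSupport_eq_mul_fibre₂ S μ ν π hν₀
  have hΦ₃ : Φ.card = (typeClass N π).card * f₃ := by
    rw [hf₃, hΦ]; exact card_typedSupport_eq_mul_fibre₃ S μ ν π hπ₀
  have hΦmin : min (typeClass N μ).card (min (typeClass N ν).card (typeClass N π).card) * f ≤
      Φ.card := by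
    have hcases : f = f₁ ∨ f = f₂ ∨ f = f₃ := by omega
    rcases hcases with h | h | h
    · rw [h, hΦ₁]
      exact Nat.mul_le_mul_right _ (min_le_left _ _)
    · rw [h, hΦ₂]
      exact Nat.mul_le_mul_right _ ((min_le_right _ _).trans (min_le_left _ _))
    · rw [h, hΦ₃]
      exact Nat.mul_le_mul_right _ ((min_le_right _ _).trans (min_le_right _ _))
  -- a Bertrand prime `6 f' < M ≤ 12 f'`
  set f' := max f b with hf'
  have hff' : f ≤ f' := le_max_left _ _
  have hbf' : b ≤ f' := le_max_right _ _
  have hf'1 : 1 ≤ f' := le_trans hf1 hff'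
  obtain ⟨M, hMp, hM1, hM2⟩ := Nat.exists_prime_lt_and_le_two_mul (6 * f') (by omega)
  haveI : NeZero M := ⟨hMp.ne_zero⟩
  have hbM : 2 * b < M := by omega
  have hM3 : 2 * (M / 2) ≤ M := Nat.mul_div_le M 2
  have hfM : 3 * f' ≤ M / 2 := by omega
  have hM12 : M ≤ 12 * f' := by omega
  obtain ⟨D₁, D₂, D₃, hD₁, hD₂, hD₃, hDcard⟩ := exists_zeroSum_diagonal M (M / 2) hM3
  obtain ⟨Δ, hΔΦ, hfree, hsize⟩ := BCS1997_thm1539_free_sub Φ αN βN γN hαN hβN hγN hαNb hβNb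
    htightN (jointTypeClass N Q) hsub hfI hfJ hfL hMp hbM D₁ D₂ D₃ hD₁ hD₂ hD₃
  refine ⟨Δ, hΔΦ, ?_, f, hf1, hΦmin, ?_⟩
  · -- freeness with respect to the coordinatewise support
    intro δ hδ δ' hδ' δ'' hδ'' hS
    have h1 := hsub (hΔΦ hδ); have h2 := hsub (hΔΦ hδ'); have h3 := hsub (hΔΦ hδ'')
    rw [hΦ, mem_typedSupport] at h1 h2 h3
    refine hfree δ hδ δ' hδ' δ'' hδ'' ?_
    rw [hΦ, mem_typedSupport]
    exact ⟨h1.1, h2.2.1, h3.2.2.1, hS⟩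
  · -- the size bound
    obtain ⟨D, hD⟩ : ∃ D : Finset (ZMod M × ZMod M × ZMod M),
        D = (D₁ ×ˢ D₂ ×ˢ D₃).filter fun d => d.1 + d.2.1 + d.2.2 = 0 := ⟨_, rfl⟩
    rw [← hD] at hsize hDcard
    set ΦQ := jointTypeClass N Q with hΦQ
    have hroth : rothNumberNat (3 * f') ≤ D.card := (rothNumberNat.mono hfM).trans hDcard
    have hM0 : (0 : ℤ) < M := by exact_mod_cast hMp.pos
    have hΦD : (0 : ℤ) ≤ (ΦQ.card : ℤ) * D.card := mul_nonneg (Nat.cast_nonneg _) (Nat.cast_nonneg _)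
    have hM6 : (6 * f : ℤ) < M := by exact_mod_cast (show 6 * f < M by omega)
    have h1 : (ΦQ.card : ℤ) * D.card * M ≤ 2 * (M : ℤ) ^ 3 * Δ.card :=
      calc (ΦQ.card : ℤ) * D.card * M ≤ (ΦQ.card : ℤ) * D.card * (2 * ((M : ℤ) - 3 * f)) :=
            mul_le_mul_of_nonneg_left (by linarith only [hM6]) hΦD
        _ = 2 * ((ΦQ.card : ℤ) * D.card * ((M : ℤ) - 3 * f)) := by ring
        _ ≤ 2 * ((M : ℤ) ^ 3 * Δ.card) := mul_le_mul_of_nonneg_left hsize (by norm_num)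
        _ = 2 * (M : ℤ) ^ 3 * Δ.card := by ring
    have h2 : (ΦQ.card : ℤ) * D.card ≤ 2 * (M : ℤ) ^ 2 * Δ.card := by
      refine le_of_mul_le_mul_right ?_ hM0
      calc (ΦQ.card : ℤ) * D.card * M ≤ 2 * (M : ℤ) ^ 3 * Δ.card := h1
        _ = 2 * (M : ℤ) ^ 2 * Δ.card * M := by ring
    have hMsq : (M : ℤ) ^ 2 ≤ (12 * f' : ℤ) ^ 2 :=
      pow_le_pow_left₀ hM0.le (by exact_mod_cast hM12) 2
    have h3 : (ΦQ.card : ℤ) * rothNumberNat (3 * f') ≤ 288 * (f' : ℤ) ^ 2 * Δ.card :=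
      calc (ΦQ.card : ℤ) * rothNumberNat (3 * f') ≤ (ΦQ.card : ℤ) * D.card :=
            mul_le_mul_of_nonneg_left (by exact_mod_cast hroth) (Nat.cast_nonneg _)
        _ ≤ 2 * (M : ℤ) ^ 2 * Δ.card := h2
        _ ≤ 2 * (12 * (f' : ℤ)) ^ 2 * Δ.card :=
            mul_le_mul_of_nonneg_right (mul_le_mul_of_nonneg_left hMsq (by norm_num))
              (Nat.cast_nonneg _)
        _ = 288 * (f' : ℤ) ^ 2 * Δ.card := by ring
    exact_mod_cast h3

end FreeDiagonal

/-! ## Entropy bounds for the type classes -/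

section Entropy

variable {I J L : Type*} [Fintype I] [Fintype J] [Fintype L] [DecidableEq I] [DecidableEq J]
  [DecidableEq L]

/-- `2^{N H(P)} ≤ (N+1)^{|I×J×L|} |Φ_Q|` for `P = Q/N` (the multinomial coefficient against the
entropy, Le Gall Lemma A.1 in the effective form of `MultinomialEntropy.lean`).
[cite: LeGall2014, Lemma A.1] -/
theorem two_rpow_le_card_jointTypeClass {N : ℕ} (Q : I × J × L → ℕ) (hQ : ∑ s, Q s = N)
    (P : I × J × L → ℝ) (hP : ∀ s, P s = (Q s : ℝ) / N) :
    (2 : ℝ) ^ ((N : ℝ) * shannonEntropy P) ≤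
      ((N : ℝ) + 1) ^ Fintype.card (I × J × L) * (jointTypeClass N Q).card := by
  rw [card_jointTypeClass_eq_card_typeClass]
  exact two_rpow_entropy_le_card_typeClass Q hQ P hP

/-- **`|Φ| ≤ (N+1)^{|I×J×L|} · 2^{N · max_{Q'} H(Q')}`**, the maximum over the distributions on `S`
with the marginals of `P = Q/N` (any count vector `Q`, `N ≥ 1`): every triple of the typed support
of the marginal types of `Q` has a joint type `τ` supported in `S` with the same marginals, there are at most `(N+1)^{|I×J×L|}` such
types, and `|Φ_τ| = binom(N; τ) ≤ 2^{N H(τ/N)} ≤ 2^{N max H}` (Le Gall p. 24: "the number of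
`1/N`-valued distributions on `S` is at most `(N+1)^{|S|}`", "`N ≤ (N+1)^{3|S|} ∏ max_Q Φ'`").
[cite: LeGall2014, Appendix A.3 (p. 24)] -/
theorem card_typedSupport_le_two_rpow_maxEntropy (S : Finset (I × J × L)) {N : ℕ} (hN : 0 < N)
    (Q : I × J × L → ℕ) (P : I × J × L → ℝ) (hP : ∀ s, P s = (Q s : ℝ) / N) :
    ((typedSupport S N (fun i => ∑ j, ∑ l, Q (i, j, l)) (fun j => ∑ i, ∑ l, Q (i, j, l))
        (fun l => ∑ i, ∑ j, Q (i, j, l))).card : ℝ) ≤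
      ((N : ℝ) + 1) ^ Fintype.card (I × J × L) *
        (2 : ℝ) ^ ((N : ℝ) * maxEntropyGivenMarginals S P) := by
  classical
  have hN0 : (N : ℝ) ≠ 0 := by exact_mod_cast hN.ne'
  -- the admissible types
  let p : (I × J × L → ℕ) → Prop := fun τ => (∀ s, s ∉ S → τ s = 0) ∧
    (∀ i, ∑ j, ∑ l, τ (i, j, l) = ∑ j, ∑ l, Q (i, j, l)) ∧
    (∀ j, ∑ i, ∑ l, τ (i, j, l) = ∑ i, ∑ l, Q (i, j, l)) ∧
    (∀ l, ∑ i, ∑ j, τ (i, j, l) = ∑ i, ∑ j, Q (i, j, l))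
  -- `Φ`, read as a set of words of triples, has admissible types
  set Φ := typedSupport S N (fun i => ∑ j, ∑ l, Q (i, j, l)) (fun j => ∑ i, ∑ l, Q (i, j, l))
    (fun l => ∑ i, ∑ j, Q (i, j, l)) with hΦ
  have hΦp : ∀ φ ∈ Φ, p (letterCount (labelSeq φ)) := by
    intro φ hφ
    obtain ⟨h1, h2, h3, h4⟩ := mem_typedSupport.1 hφ
    refine ⟨fun s hs => ?_, fun i => ?_, fun j => ?_, fun l => ?_⟩
    · rw [letterCount_apply, Finset.card_eq_zero, Finset.filter_eq_empty_iff]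
      intro ρ _ hρ
      exact hs (hρ ▸ h4 ρ)
    · rw [← letterCount_fst]; exact congrFun h1 i
    · rw [← letterCount_snd_fst]; exact congrFun h2 j
    · rw [← letterCount_snd_snd]; exact congrFun h3 l
  -- so `|Φ| ≤ #{words with admissible type}`
  have hcard : Φ.card ≤ (Finset.univ.filter fun u : Fin N → I × J × L => p (letterCount u)).card := by
    refine Finset.card_le_card_of_injOn (fun φ => labelSeqEquiv N φ) (fun φ hφ => ?_)
      (fun φ₁ _ φ₂ _ h => (labelSeqEquiv N).injective h)
    exact Finset.mem_coe.2 (Finset.mem_filter.2 ⟨Finset.mem_univ _, hΦp φ (Finset.mem_coe.1 hφ)⟩)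
  -- each admissible type class has at most `2^{N max H}` words
  set B : ℝ := (2 : ℝ) ^ ((N : ℝ) * maxEntropyGivenMarginals S P) with hB
  have hB0 : 0 ≤ B := Real.rpow_nonneg zero_le_two _
  have hclass : ∀ τ, p τ →
      ((Finset.univ.filter fun u : Fin N → I × J × L => letterCount u = τ).card : ℝ) ≤ B := by
    intro τ hτ
    by_cases hne : (Finset.univ.filter fun u : Fin N → I × J × L => letterCount u = τ).Nonempty
    · obtain ⟨u, hu⟩ := hne
      have hτu : letterCount u = τ := (Finset.mem_filter.1 hu).2
      have hτsum : ∑ s, τ s = N := by rw [← hτu]; exact sum_letterCount u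
      -- the class is `typeClass N τ`, of size `binom(N;τ) ≤ 2^{N H(τ/N)}`
      have hcl : (Finset.univ.filter fun u : Fin N → I × J × L => letterCount u = τ) =
          typeClass N τ := rfl
      rw [hcl, card_typeClass_eq_multinomial N τ hτsum]
      refine (multinomial_le_two_rpow_mul_shannonEntropy τ hτsum).trans ?_
      refine Real.rpow_le_rpow_of_exponent_le one_le_two (mul_le_mul_of_nonneg_left ?_ (Nat.cast_nonneg _))
      -- `τ/N` has the marginals of `P` and is supported in `S`
      refine shannonEntropy_le_maxEntropyGivenMarginals (mem_sameMarginalsOn.2 ⟨?_, ?_, ?_, ?_, ?_⟩)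
      · refine ⟨fun s => div_nonneg (Nat.cast_nonneg _) (Nat.cast_nonneg _), ?_⟩
        rw [← Finset.sum_div, ← Nat.cast_sum, hτsum, div_self hN0]
      · intro s hs
        simp [hτ.1 s hs]
      · funext i
        simp only [marginalDist₁, hP, ← Finset.sum_div]
        congr 1
        exact_mod_cast hτ.2.1 i
      · funext j
        simp only [marginalDist₂, hP, ← Finset.sum_div]
        congr 1
        exact_mod_cast hτ.2.2.1 j
      · funext l
        simp only [marginalDist₃, hP, ← Finset.sum_div]
        congr 1
        exact_mod_cast hτ.2.2.2 l
    · rw [Finset.not_nonempty_iff_eq_empty.1 hne, Finset.card_empty, Nat.cast_zero]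
      exact hB0
  have h := card_filter_letterCount_le p hB0 hclass
  calc (Φ.card : ℝ) ≤ (Finset.univ.filter fun u : Fin N → I × J × L => p (letterCount u)).card := by
        exact_mod_cast hcard
    _ ≤ ((N : ℝ) + 1) ^ Fintype.card (I × J × L) * B := by
        simpa using h

end Entropy

/-! ## The counting bound -/

section Count

variable {I J L : Type*} [Fintype I] [Fintype J] [Fintype L] [DecidableEq I] [DecidableEq J]
  [DecidableEq L]

/-- **The free diagonal of one joint type is large**: in the setting of
`exists_free_diagonal_jointType`, with `P = Q/N` (`N ≥ 1`),
`2^{N (min_m H(P_m) − Γ_S(P))} ≤ |Δ| · (N+1)^{2G+A} · 96 b' · exp(4 √(log 3b' + N log G))`,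
`G = |I×J×L|`, `A = |I|+|J|+|L|`, `b' = max(b,1)`, `Γ_S = maxEntropyPenalty S` — the effective form
of Le Gall's `|Δ| ≥ c T N*/N^{1+ε}` combined with Lemma A.1 and the count of types (p. 24), with
Behrend's bound `rothNumberNat(n) ≥ n e^{-4√log n}` for the Salem–Spencer loss.
[cite: LeGall2014, Appendix A.3, Eq. (7) and p. 24] -/
theorem exists_free_diagonal_jointType_card (S : Finset (I × J × L)) {r b : ℕ}
    (α : I → Fin r → ℤ) (β : J → Fin r → ℤ) (γ : L → Fin r → ℤ)
    (hα : Function.Injective α) (hβ : Function.Injective β) (hγ : Function.Injective γ)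
    (hαb : ∀ i ρ, |α i ρ| ≤ b) (hβb : ∀ j ρ, |β j ρ| ≤ b)
    (htight : ∀ s ∈ S, ∀ ρ, α s.1 ρ + β s.2.1 ρ + γ s.2.2 ρ = 0)
    {N : ℕ} (hN : 0 < N) (Q : I × J × L → ℕ) (hQS : ∀ s, s ∉ S → Q s = 0) (hQ : ∑ s, Q s = N)
    (P : I × J × L → ℝ) (hP : ∀ s, P s = (Q s : ℝ) / N) :
    ∃ Δ : Finset ((Fin N → I) × (Fin N → J) × (Fin N → L)), Δ ⊆ jointTypeClass N Q ∧
      (∀ δ ∈ Δ, ∀ δ' ∈ Δ, ∀ δ'' ∈ Δ, (∀ ρ, (δ.1 ρ, δ'.2.1 ρ, δ''.2.2 ρ) ∈ S) →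
        δ = δ' ∧ δ' = δ'') ∧
      (2 : ℝ) ^ ((N : ℝ) * (min (shannonEntropy (marginalDist₁ P))
          (min (shannonEntropy (marginalDist₂ P)) (shannonEntropy (marginalDist₃ P))) -
          maxEntropyPenalty S P)) ≤
        Δ.card * (((N : ℝ) + 1) ^ (2 * Fintype.card (I × J × L) +
            (Fintype.card I + Fintype.card J + Fintype.card L)) * (96 * ((max b 1 : ℕ) : ℝ)) *
          Real.exp (4 * √(Real.log ((3 * max b 1 : ℕ) : ℝ) +
            (N : ℝ) * Real.log (Fintype.card (I × J × L) : ℝ)))) := by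
  classical
  obtain ⟨Δ, hΔQ, hfree, f, hf1, hΦmin, hsize⟩ :=
    exists_free_diagonal_jointType S α β γ hα hβ hγ hαb hβb htight Q hQS hQ
  refine ⟨Δ, hΔQ, hfree, ?_⟩
  -- notation
  set μ : I → ℕ := fun i => ∑ j, ∑ l, Q (i, j, l) with hμ
  set ν : J → ℕ := fun j => ∑ i, ∑ l, Q (i, j, l) with hν
  set π : L → ℕ := fun l => ∑ i, ∑ j, Q (i, j, l) with hπ
  set Φ := typedSupport S N μ ν π with hΦ
  set ΦQ := jointTypeClass N Q with hΦQ
  set G : ℕ := Fintype.card (I × J × L) with hG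
  set A : ℕ := Fintype.card I + Fintype.card J + Fintype.card L with hA
  set b' : ℕ := max b 1 with hb'
  set f' : ℕ := max f b with hf'
  set Tmin : ℕ := min (typeClass N μ).card (min (typeClass N ν).card (typeClass N π).card)
    with hTmin
  set Hmin : ℝ := min (shannonEntropy (marginalDist₁ P))
    (min (shannonEntropy (marginalDist₂ P)) (shannonEntropy (marginalDist₃ P))) with hHmin
  set Hmax : ℝ := maxEntropyGivenMarginals S P with hHmax
  have hN0' : (0 : ℝ) < N := by exact_mod_cast hN
  -- the marginal sums and the marginals of `P`
  have hμsum : ∑ i, μ i = N := by rw [← hQ, sum_triple_eq]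
  have hνsum : ∑ j, ν j = N := by
    rw [← hQ, sum_triple_eq, hν]
    exact Finset.sum_comm
  have hπsum : ∑ l, π l = N := by
    rw [← hQ, sum_triple_eq, hπ]
    calc ∑ l, ∑ i, ∑ j, Q (i, j, l) = ∑ i, ∑ l, ∑ j, Q (i, j, l) := Finset.sum_comm
      _ = ∑ i, ∑ j, ∑ l, Q (i, j, l) := Finset.sum_congr rfl fun i _ => Finset.sum_comm
  have hPμ : ∀ i, marginalDist₁ P i = (μ i : ℝ) / N := fun i => by
    simp only [marginalDist₁, hP, hμ, Nat.cast_sum, Finset.sum_div]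
  have hPν : ∀ j, marginalDist₂ P j = (ν j : ℝ) / N := fun j => by
    simp only [marginalDist₂, hP, hν, Nat.cast_sum, Finset.sum_div]
  have hPπ : ∀ l, marginalDist₃ P l = (π l : ℝ) / N := fun l => by
    simp only [marginalDist₃, hP, hπ, Nat.cast_sum, Finset.sum_div]
  -- (1) `2^{N Hmin} ≤ (N+1)^A Tmin`
  have hF1 : (2 : ℝ) ^ ((N : ℝ) * Hmin) ≤ ((N : ℝ) + 1) ^ A * Tmin := by
    have hH1 : Hmin ≤ shannonEntropy (marginalDist₁ P) := min_le_left _ _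
    have hH2 : Hmin ≤ shannonEntropy (marginalDist₂ P) := (min_le_right _ _).trans (min_le_left _ _)
    have hH3 : Hmin ≤ shannonEntropy (marginalDist₃ P) :=
      (min_le_right _ _).trans (min_le_right _ _)
    have hA1 : Fintype.card I ≤ A := by rw [hA]; omega
    have hA2 : Fintype.card J ≤ A := by rw [hA]; omega
    have hA3 : Fintype.card L ≤ A := by rw [hA]; omega
    have h1 := two_rpow_le_card_typeClass_of_le μ hμsum (marginalDist₁ P) hPμ hH1 hA1
    have h2 := two_rpow_le_card_typeClass_of_le ν hνsum (marginalDist₂ P) hPν hH2 hA2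
    have h3 := two_rpow_le_card_typeClass_of_le π hπsum (marginalDist₃ P) hPπ hH3 hA3
    have hA0 : (0 : ℝ) ≤ ((N : ℝ) + 1) ^ A := by positivity
    have e : ((N : ℝ) + 1) ^ A * (Tmin : ℝ) = min (((N : ℝ) + 1) ^ A * (typeClass N μ).card)
        (min (((N : ℝ) + 1) ^ A * (typeClass N ν).card)
          (((N : ℝ) + 1) ^ A * (typeClass N π).card)) := by
      rw [hTmin, Nat.cast_min, Nat.cast_min, mul_min_of_nonneg _ _ hA0, mul_min_of_nonneg _ _ hA0]
    rw [e]
    exact le_min h1 (le_min h2 h3)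
  -- (2) `2^{N H(P)} ≤ (N+1)^G |Φ_Q|`
  have hF2 : (2 : ℝ) ^ ((N : ℝ) * shannonEntropy P) ≤ ((N : ℝ) + 1) ^ G * ΦQ.card :=
    two_rpow_le_card_jointTypeClass Q hQ P hP
  -- (3) `|Φ| ≤ (N+1)^G 2^{N Hmax}`
  have hF3 : (Φ.card : ℝ) ≤ ((N : ℝ) + 1) ^ G * (2 : ℝ) ^ ((N : ℝ) * Hmax) :=
    card_typedSupport_le_two_rpow_maxEntropy S hN Q P hP
  -- (4) the hashing bound and Behrend
  have hf'1 : 1 ≤ f' := le_trans hf1 (le_max_left _ _)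
  have hb'1 : 1 ≤ b' := le_max_right _ _
  have hf'le : f' ≤ b' * f := by
    rcases le_total b f with hbf | hfb
    · rw [hf', max_eq_left hbf]; exact Nat.le_mul_of_pos_left f hb'1
    · rw [hf', max_eq_right hfb]
      exact le_trans (le_max_left b 1) (Nat.le_mul_of_pos_right _ hf1)
  set sB : ℝ := 4 * √(Real.log ((3 * f' : ℕ) : ℝ)) with hsB
  have hBeh : ((3 * f' : ℕ) : ℝ) * Real.exp (-sB) ≤ rothNumberNat (3 * f') := by
    rw [hsB, show -(4 * √(Real.log ((3 * f' : ℕ) : ℝ))) = -4 * √(Real.log ((3 * f' : ℕ) : ℝ)) by ring]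
    exact Behrend.roth_lower_bound
  -- `f ≤ |Φ| ≤ G^N`, so `sB ≤ 4 √(log 3b' + N log G)`
  have hfΦ : f ≤ Φ.card := le_trans (Nat.le_mul_of_pos_left f (by
      have h1N : (0 : ℝ) < ((N : ℝ) + 1) ^ A * Tmin := lt_of_lt_of_le (Real.rpow_pos_of_pos two_pos _) hF1
      have : (0 : ℝ) < Tmin := pos_of_mul_pos_right h1N (by positivity) |>.trans_le' le_rfl
      exact_mod_cast this)) hΦmin
  have hΦG : Φ.card ≤ G ^ N := by
    refine (Finset.card_le_univ _).trans ?_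
    simp only [Fintype.card_prod, Fintype.card_fun, Fintype.card_fin, hG]
    rw [mul_pow, mul_pow]
  have hfG : f ≤ G ^ N := hfΦ.trans hΦG
  have hG1 : 1 ≤ G := by
    have : 1 ≤ G ^ N := hf1.trans hfG
    rcases Nat.eq_zero_or_pos G with h0 | h0
    · rw [h0, zero_pow hN.ne'] at this; omega
    · exact h0
  have hlog3f' : Real.log ((3 * f' : ℕ) : ℝ) ≤
      Real.log ((3 * b' : ℕ) : ℝ) + (N : ℝ) * Real.log (G : ℝ) := by
    have h1 : ((3 * f' : ℕ) : ℝ) ≤ ((3 * b' : ℕ) : ℝ) * (G : ℝ) ^ N := by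
      have : 3 * f' ≤ 3 * b' * G ^ N :=
        calc 3 * f' ≤ 3 * (b' * f) := Nat.mul_le_mul_left 3 hf'le
          _ ≤ 3 * (b' * G ^ N) := Nat.mul_le_mul_left 3 (Nat.mul_le_mul_left _ hfG)
          _ = 3 * b' * G ^ N := by ring
      exact_mod_cast this
    have hG0 : (0 : ℝ) < G := by exact_mod_cast hG1
    calc Real.log ((3 * f' : ℕ) : ℝ) ≤ Real.log (((3 * b' : ℕ) : ℝ) * (G : ℝ) ^ N) :=
          Real.log_le_log (by positivity) h1
      _ = Real.log ((3 * b' : ℕ) : ℝ) + (N : ℝ) * Real.log (G : ℝ) := by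
          rw [Real.log_mul (by positivity) (by positivity), Real.log_pow]
  have hsB_le : sB ≤ 4 * √(Real.log ((3 * b' : ℕ) : ℝ) + (N : ℝ) * Real.log (G : ℝ)) := by
    rw [hsB]; exact mul_le_mul_of_nonneg_left (Real.sqrt_le_sqrt hlog3f') (by norm_num)
  -- real-arithmetic assembly
  have hf0 : (0 : ℝ) < f := by exact_mod_cast hf1
  have hf'0 : (0 : ℝ) < f' := by exact_mod_cast hf'1
  have hb'0 : (0 : ℝ) < b' := by exact_mod_cast hb'1
  have hf'b : (f' : ℝ) ≤ (b' : ℝ) * f := by exact_mod_cast hf'le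
  have hexp : 0 < Real.exp (-sB) := Real.exp_pos _
  have hsize' : (ΦQ.card : ℝ) * rothNumberNat (3 * f') ≤ 288 * (f' : ℝ) ^ 2 * Δ.card := by
    have e2 : (f' : ℝ) = ((max f b : ℕ) : ℝ) := by rw [hf']
    rw [e2]; exact_mod_cast hsize
  -- `|Φ_Q| e^{-sB} ≤ 96 b' f |Δ|`
  have h5 : (ΦQ.card : ℝ) * Real.exp (-sB) ≤ 96 * (b' : ℝ) * f * Δ.card := by
    have h51 : (ΦQ.card : ℝ) * (3 * (f' : ℝ) * Real.exp (-sB)) ≤ 288 * (f' : ℝ) ^ 2 * Δ.card := by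
      have hBeh' : 3 * (f' : ℝ) * Real.exp (-sB) ≤ rothNumberNat (3 * f') := by
        have : ((3 * f' : ℕ) : ℝ) = 3 * (f' : ℝ) := by push_cast; ring
        rw [← this]; exact hBeh
      exact le_trans (mul_le_mul_of_nonneg_left hBeh' (Nat.cast_nonneg _)) hsize'
    have h52 : (ΦQ.card : ℝ) * Real.exp (-sB) * (3 * f') ≤ (96 * (f' : ℝ) * Δ.card) * (3 * f') := by
      calc (ΦQ.card : ℝ) * Real.exp (-sB) * (3 * f') = (ΦQ.card : ℝ) * (3 * (f' : ℝ) * Real.exp (-sB)) := by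
            ring
        _ ≤ 288 * (f' : ℝ) ^ 2 * Δ.card := h51
        _ = (96 * (f' : ℝ) * Δ.card) * (3 * f') := by ring
    have h53 : (ΦQ.card : ℝ) * Real.exp (-sB) ≤ 96 * (f' : ℝ) * Δ.card :=
      le_of_mul_le_mul_right h52 (by positivity)
    calc (ΦQ.card : ℝ) * Real.exp (-sB) ≤ 96 * (f' : ℝ) * Δ.card := h53
      _ ≤ 96 * ((b' : ℝ) * f) * Δ.card := by gcongr
      _ = 96 * (b' : ℝ) * f * Δ.card := by ring
  -- multiply by `Tmin` and use `Tmin f ≤ |Φ|`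
  have hTf : (Tmin : ℝ) * f ≤ Φ.card := by exact_mod_cast hΦmin
  have h6 : (ΦQ.card : ℝ) * Real.exp (-sB) * Tmin ≤ 96 * (b' : ℝ) * Φ.card * Δ.card := by
    calc (ΦQ.card : ℝ) * Real.exp (-sB) * Tmin ≤ (96 * (b' : ℝ) * f * Δ.card) * Tmin :=
          mul_le_mul_of_nonneg_right h5 (Nat.cast_nonneg _)
      _ = 96 * (b' : ℝ) * ((Tmin : ℝ) * f) * Δ.card := by ring
      _ ≤ 96 * (b' : ℝ) * Φ.card * Δ.card := by gcongr
  -- combine with (1)–(3)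
  have h7 : (2 : ℝ) ^ ((N : ℝ) * shannonEntropy P) * (2 : ℝ) ^ ((N : ℝ) * Hmin) * Real.exp (-sB) ≤
      ((N : ℝ) + 1) ^ (2 * G + A) * (96 * (b' : ℝ)) * (2 : ℝ) ^ ((N : ℝ) * Hmax) * Δ.card := by
    calc (2 : ℝ) ^ ((N : ℝ) * shannonEntropy P) * (2 : ℝ) ^ ((N : ℝ) * Hmin) * Real.exp (-sB)
        ≤ (((N : ℝ) + 1) ^ G * ΦQ.card) * (((N : ℝ) + 1) ^ A * Tmin) * Real.exp (-sB) := by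
          gcongr
      _ = ((N : ℝ) + 1) ^ (G + A) * ((ΦQ.card : ℝ) * Real.exp (-sB) * Tmin) := by
          rw [pow_add]; ring
      _ ≤ ((N : ℝ) + 1) ^ (G + A) * (96 * (b' : ℝ) * Φ.card * Δ.card) :=
          mul_le_mul_of_nonneg_left h6 (by positivity)
      _ ≤ ((N : ℝ) + 1) ^ (G + A) * (96 * (b' : ℝ) * (((N : ℝ) + 1) ^ G * (2 : ℝ) ^ ((N : ℝ) * Hmax)) *
            Δ.card) := by gcongr
      _ = ((N : ℝ) + 1) ^ (2 * G + A) * (96 * (b' : ℝ)) * (2 : ℝ) ^ ((N : ℝ) * Hmax) * Δ.card := by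
          rw [show 2 * G + A = (G + A) + G by ring, pow_add]; ring
  -- divide by `2^{N Hmax} e^{-sB}`
  have hpen : maxEntropyPenalty S P = Hmax - shannonEntropy P := rfl
  have hexpN : (2 : ℝ) ^ ((N : ℝ) * (Hmin - maxEntropyPenalty S P)) =
      (2 : ℝ) ^ ((N : ℝ) * shannonEntropy P) * (2 : ℝ) ^ ((N : ℝ) * Hmin) *
        ((2 : ℝ) ^ ((N : ℝ) * Hmax))⁻¹ := by
    rw [hpen, ← Real.rpow_neg zero_le_two, ← Real.rpow_add two_pos, ← Real.rpow_add two_pos]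
    ring_nf
  have h2Hmax : (0 : ℝ) < (2 : ℝ) ^ ((N : ℝ) * Hmax) := Real.rpow_pos_of_pos two_pos _
  have h8 : (2 : ℝ) ^ ((N : ℝ) * (Hmin - maxEntropyPenalty S P)) * Real.exp (-sB) ≤
      Δ.card * (((N : ℝ) + 1) ^ (2 * G + A) * (96 * (b' : ℝ))) := by
    rw [hexpN]
    have := div_le_div_of_nonneg_right h7 h2Hmax.le
    rw [show ((N : ℝ) + 1) ^ (2 * G + A) * (96 * (b' : ℝ)) * (2 : ℝ) ^ ((N : ℝ) * Hmax) * Δ.card /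
        (2 : ℝ) ^ ((N : ℝ) * Hmax) = Δ.card * (((N : ℝ) + 1) ^ (2 * G + A) * (96 * (b' : ℝ))) by
      field_simp] at this
    calc (2 : ℝ) ^ ((N : ℝ) * shannonEntropy P) * (2 : ℝ) ^ ((N : ℝ) * Hmin) *
          ((2 : ℝ) ^ ((N : ℝ) * Hmax))⁻¹ * Real.exp (-sB)
        = (2 : ℝ) ^ ((N : ℝ) * shannonEntropy P) * (2 : ℝ) ^ ((N : ℝ) * Hmin) * Real.exp (-sB) /
            (2 : ℝ) ^ ((N : ℝ) * Hmax) := by rw [div_eq_mul_inv]; ring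
      _ ≤ Δ.card * (((N : ℝ) + 1) ^ (2 * G + A) * (96 * (b' : ℝ))) := this
  -- move `e^{-sB}` to the right and bound `sB`
  have h9 : (2 : ℝ) ^ ((N : ℝ) * (Hmin - maxEntropyPenalty S P)) ≤
      Δ.card * (((N : ℝ) + 1) ^ (2 * G + A) * (96 * (b' : ℝ))) * Real.exp sB := by
    have := mul_le_mul_of_nonneg_right h8 (Real.exp_pos sB).le
    rwa [mul_assoc, ← Real.exp_add, neg_add_cancel, Real.exp_zero, mul_one] at this
  have hcastb : ((max b 1 : ℕ) : ℝ) = (b' : ℝ) := by rw [hb']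
  have hcast3 : ((3 * max b 1 : ℕ) : ℝ) = ((3 * b' : ℕ) : ℝ) := by rw [hb']
  rw [hcastb, hcast3]
  refine h9.trans ?_
  rw [mul_assoc (Δ.card : ℝ)]
  refine mul_le_mul_of_nonneg_left (mul_le_mul_of_nonneg_left (Real.exp_le_exp.2 hsB_le)
    (by positivity)) (Nat.cast_nonneg _)

end Count

end Literature.Computability.AlgebraicComplexity
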